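import Summits.AtomisticToContinuum.Crystallization.Theorems.MinimisingLawsHaveAtoms.Negative.DilationFamily
import Summits.AtomisticToContinuum.Crystallization.Theorems.LayeredLawsSelectHcp.Negative.FccModel
import Summits.AtomisticToContinuum.Crystallization.Theorems.PalmUnimodularRigidityUnimodularEnergyLowerBoundHardCore
import Mathlib.Data.Real.Pointwise

/-!
# Negative knowledge for crux `MinimisingLawsHaveAtoms` (stmt-AtomisticToContinuum-15776), XI:
# the first-shell radius — a Borel, dilation-equivariant functional of rooted configurations that
# a rooted isometry class confines to a countable set

Standing crux disprover `cdisprove-stmt-AtomisticToContinuum-15776`,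
`--supports stmt-AtomisticToContinuum-15776`; sixth piece of the threshold-sharpness programme
(the isometry-diffuseness of the randomly dilated law, Part XII, is a Fubini argument on the level
sets of this functional).  Definition-free: the functional is written out as
`ρ(S) = ⨆ (q : ℚ) (_ : count|S (B̄(0, q)) ≤ 1), ofReal q ∈ [0, ∞]` — the supremum of the rational
radii whose closed ball about the root contains no other point.

* `measurable_firstShell` — `ρ` is Borel on `RootedHardCoreConfig ℝ³ δ` (countably many
  evaluations of the landed measurable `S ↦ count|S`);
* `firstShell_eq_top_iff` — `ρ(S) = ⊤` iff the configuration is the root alone;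
* `firstShell_eq_ofReal_sInf` — otherwise `ρ(S) = ofReal (inf {‖z‖ : z ∈ S, z ≠ 0})`, so
* `firstShell_dilate` — `ρ((max c 1) • S) = ofReal (max c 1) · ρ(S)`, and
* `firstShell_mem_of_mem_rootedClass` — if `count|S` lies in the rooted isometry class of `Y`
  then `ρ(S) = ⊤` or `ρ(S) = ofReal (inf {dist y q : y ∈ Y, y ≠ q})` for some `q ∈ Y`: on the
  class of `Y` the functional takes values in a set indexed by `Y` (countable as soon as the class
  meets the hard-core configurations, `countable_of_mem_rootedClass`).
All `[folklore]`.
-/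

noncomputable section

namespace Summit.AtomisticToContinuum.Crystallization.Theorems.MinimisingLawsHaveAtoms.Negative.FirstShellRadius

open MeasureTheory Set Filter Metric Function
open scoped ENNReal Topology Pointwise
open Literature.MathematicalPhysics.StatisticalMechanics Literature.Probability.Process
open Literature.Probability.Process.LocalConfig
open Summit.AtomisticToContinuum.Crystallization.Theorems.LayeredLawsSelectHcp.Negative.FccModel
  (set_eq_of_count_restrict_eq)
open Summit.AtomisticToContinuum.Crystallization.Theorems.MinimisingLawsHaveAtoms.Negative.DilationFamily

variable {δ : ℝ}

/-! ## §1 Balls about the root and the other points -/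

/-- The closed ball of radius `q` about the root contains at most the root iff no other point has
norm `≤ q`. [folklore] -/
theorem toMeasure_closedBall_le_one_iff
    (S : RootedHardCoreConfig (EuclideanSpace ℝ (Fin 3)) δ) (q : ℝ) :
    ((S.1 : LocalConfig (EuclideanSpace ℝ (Fin 3))).toMeasure) (closedBall 0 q) ≤ 1 ↔
      ∀ z ∈ ((S.1 : LocalConfig (EuclideanSpace ℝ (Fin 3))) : Set (EuclideanSpace ℝ (Fin 3))),
        z ≠ 0 → q < ‖z‖ := by
  rw [toMeasure_def, Measure.restrict_apply measurableSet_closedBall]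
  constructor
  · intro h z hz hz0
    by_contra hq
    rw [not_lt] at hq
    have h2 : ({0, z} : Set (EuclideanSpace ℝ (Fin 3))) ⊆ closedBall 0 q ∩
        ((S.1 : LocalConfig (EuclideanSpace ℝ (Fin 3))) : Set (EuclideanSpace ℝ (Fin 3))) := by
      intro w hw
      rcases hw with rfl | rfl
      · exact ⟨mem_closedBall_self ((norm_nonneg z).trans hq), S.2.1⟩
      · exact ⟨mem_closedBall_zero_iff.2 hq, hz⟩
    have h3 : (2 : ℝ≥0∞) ≤ Measure.count (closedBall (0 : EuclideanSpace ℝ (Fin 3)) q ∩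
        ((S.1 : LocalConfig (EuclideanSpace ℝ (Fin 3))) : Set (EuclideanSpace ℝ (Fin 3)))) := by
      calc (2 : ℝ≥0∞) = Measure.count ({0, z} : Set (EuclideanSpace ℝ (Fin 3))) := by
            rw [show ({0, z} : Set (EuclideanSpace ℝ (Fin 3))) =
              ↑({0, z} : Finset (EuclideanSpace ℝ (Fin 3))) by simp, Measure.count_apply_finset,
              Finset.card_pair (Ne.symm hz0)]
            norm_num
        _ ≤ _ := measure_mono h2
    exact absurd (h3.trans h) (by norm_num)
  · intro h
    have hsub : closedBall (0 : EuclideanSpace ℝ (Fin 3)) q ∩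
        ((S.1 : LocalConfig (EuclideanSpace ℝ (Fin 3))) : Set (EuclideanSpace ℝ (Fin 3))) ⊆ {0} := by
      rintro w ⟨hwq, hwS⟩
      by_contra hw0
      have := h w hwS hw0
      rw [mem_closedBall_zero_iff] at hwq
      linarith
    calc Measure.count (closedBall (0 : EuclideanSpace ℝ (Fin 3)) q ∩ _)
        ≤ Measure.count ({0} : Set (EuclideanSpace ℝ (Fin 3))) := measure_mono hsub
      _ = 1 := Measure.count_singleton _

/-! ## §2 The first-shell radius: measurability and values -/

/-- **The first-shell radius is Borel** on rooted `δ`-hard-core configurations. [folklore] -/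
theorem measurable_firstShell (hδ : 0 < δ) :
    Measurable fun S : RootedHardCoreConfig (EuclideanSpace ℝ (Fin 3)) δ =>
      ⨆ (q : ℚ) (_ : ((S.1 : LocalConfig (EuclideanSpace ℝ (Fin 3))).toMeasure) (closedBall 0 q) ≤ 1),
        ENNReal.ofReal q := by
  refine Measurable.iSup fun q => ?_
  have hm : Measurable fun S : RootedHardCoreConfig (EuclideanSpace ℝ (Fin 3)) δ =>
      ((S.1 : LocalConfig (EuclideanSpace ℝ (Fin 3))).toMeasure) (closedBall 0 q) :=
    (Measure.measurable_coe measurableSet_closedBall).comp (measurable_toMeasure hδ)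
  have hset : MeasurableSet {S : RootedHardCoreConfig (EuclideanSpace ℝ (Fin 3)) δ |
      ((S.1 : LocalConfig (EuclideanSpace ℝ (Fin 3))).toMeasure) (closedBall 0 q) ≤ 1} :=
    hm measurableSet_Iic
  have : (fun S : RootedHardCoreConfig (EuclideanSpace ℝ (Fin 3)) δ =>
      ⨆ (_ : ((S.1 : LocalConfig (EuclideanSpace ℝ (Fin 3))).toMeasure) (closedBall 0 q) ≤ 1),
        ENNReal.ofReal (q : ℝ)) =
      {S : RootedHardCoreConfig (EuclideanSpace ℝ (Fin 3)) δ |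
        ((S.1 : LocalConfig (EuclideanSpace ℝ (Fin 3))).toMeasure) (closedBall 0 q) ≤ 1}.indicator
        fun _ => ENNReal.ofReal (q : ℝ) := by
    funext S
    by_cases hS : ((S.1 : LocalConfig (EuclideanSpace ℝ (Fin 3))).toMeasure) (closedBall 0 q) ≤ 1
    · rw [indicator_of_mem (show S ∈ {S : RootedHardCoreConfig (EuclideanSpace ℝ (Fin 3)) δ |
        ((S.1 : LocalConfig (EuclideanSpace ℝ (Fin 3))).toMeasure) (closedBall 0 q) ≤ 1} from hS)]
      simp [hS]
    · rw [indicator_of_notMem (show S ∉ {S : RootedHardCoreConfig (EuclideanSpace ℝ (Fin 3)) δ |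
        ((S.1 : LocalConfig (EuclideanSpace ℝ (Fin 3))).toMeasure) (closedBall 0 q) ≤ 1} from hS)]
      simp [hS]
  rw [this]
  exact measurable_const.indicator hset

/-- **`ρ(S) = ⊤` iff the configuration is the root alone.** [folklore] -/
theorem firstShell_eq_top_iff (S : RootedHardCoreConfig (EuclideanSpace ℝ (Fin 3)) δ) :
    (⨆ (q : ℚ) (_ : ((S.1 : LocalConfig (EuclideanSpace ℝ (Fin 3))).toMeasure) (closedBall 0 q) ≤ 1),
        ENNReal.ofReal (q : ℝ)) = ⊤ ↔
      ((S.1 : LocalConfig (EuclideanSpace ℝ (Fin 3))) : Set (EuclideanSpace ℝ (Fin 3))) = {0} := by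
  constructor
  · intro h
    refine Set.eq_singleton_iff_unique_mem.2 ⟨S.2.1, fun z hz => ?_⟩
    by_contra hz0
    -- every admissible radius is `< ‖z‖`, so the supremum is `≤ ‖z‖ < ⊤`
    have hle : (⨆ (q : ℚ) (_ : ((S.1 : LocalConfig (EuclideanSpace ℝ (Fin 3))).toMeasure)
        (closedBall 0 q) ≤ 1), ENNReal.ofReal (q : ℝ)) ≤ ENNReal.ofReal ‖z‖ := by
      refine iSup_le fun q => iSup_le fun hq => ?_
      exact ENNReal.ofReal_le_ofReal ((toMeasure_closedBall_le_one_iff S q).1 hq z hz hz0).le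
    rw [h] at hle
    exact absurd hle (by simp)
  · intro h
    refine ENNReal.eq_top_of_forall_nnreal_le fun r => ?_
    obtain ⟨q, hq⟩ := exists_rat_gt (r : ℝ)
    have hadm : ((S.1 : LocalConfig (EuclideanSpace ℝ (Fin 3))).toMeasure) (closedBall 0 q) ≤ 1 := by
      rw [toMeasure_closedBall_le_one_iff]
      intro z hz hz0
      rw [h, mem_singleton_iff] at hz
      exact absurd hz hz0
    calc (r : ℝ≥0∞) = ENNReal.ofReal (r : ℝ) := by simp
      _ ≤ ENNReal.ofReal (q : ℝ) := ENNReal.ofReal_le_ofReal hq.le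
      _ ≤ _ := le_iSup₂ (f := fun (q : ℚ) (_ : ((S.1 : LocalConfig (EuclideanSpace ℝ (Fin 3))).toMeasure)
          (closedBall 0 q) ≤ 1) => ENNReal.ofReal (q : ℝ)) q hadm

/-- **Otherwise `ρ(S)` is the infimum of the norms of the other points**:
`ρ(S) = ofReal (inf {‖z‖ : z ∈ S, z ≠ 0})` whenever `S` has a point other than the root.
[folklore] -/
theorem firstShell_eq_ofReal_sInf (S : RootedHardCoreConfig (EuclideanSpace ℝ (Fin 3)) δ)
    (hS : ∃ z ∈ ((S.1 : LocalConfig (EuclideanSpace ℝ (Fin 3))) : Set (EuclideanSpace ℝ (Fin 3))),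
      z ≠ 0) :
    (⨆ (q : ℚ) (_ : ((S.1 : LocalConfig (EuclideanSpace ℝ (Fin 3))).toMeasure) (closedBall 0 q) ≤ 1),
        ENNReal.ofReal (q : ℝ)) =
      ENNReal.ofReal (sInf {r : ℝ | ∃ z ∈ ((S.1 : LocalConfig (EuclideanSpace ℝ (Fin 3))) :
        Set (EuclideanSpace ℝ (Fin 3))), z ≠ 0 ∧ r = ‖z‖}) := by
  set N : Set ℝ := {r : ℝ | ∃ z ∈ ((S.1 : LocalConfig (EuclideanSpace ℝ (Fin 3))) :
    Set (EuclideanSpace ℝ (Fin 3))), z ≠ 0 ∧ r = ‖z‖} with hN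
  obtain ⟨z₀, hz₀, hz₀0⟩ := hS
  have hNne : N.Nonempty := ⟨‖z₀‖, z₀, hz₀, hz₀0, rfl⟩
  have hNbdd : BddBelow N := ⟨0, fun r hr => by
    obtain ⟨z, -, -, rfl⟩ := hr
    exact norm_nonneg z⟩
  have hN0 : 0 ≤ sInf N := Real.sInf_nonneg fun r hr => by
    obtain ⟨z, -, -, rfl⟩ := hr
    exact norm_nonneg z
  -- admissible radii are `≤ inf N`, radii `< inf N` are admissible
  have hadm_le : ∀ q : ℚ, ((S.1 : LocalConfig (EuclideanSpace ℝ (Fin 3))).toMeasure)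
      (closedBall 0 q) ≤ 1 → (q : ℝ) ≤ sInf N := fun q hq => by
    refine le_csInf hNne fun r hr => ?_
    obtain ⟨z, hz, hz0, rfl⟩ := hr
    exact ((toMeasure_closedBall_le_one_iff S q).1 hq z hz hz0).le
  have hlt_adm : ∀ q : ℚ, (q : ℝ) < sInf N → ((S.1 : LocalConfig (EuclideanSpace ℝ (Fin 3))).toMeasure)
      (closedBall 0 q) ≤ 1 := fun q hq => by
    rw [toMeasure_closedBall_le_one_iff]
    intro z hz hz0
    exact hq.trans_le (csInf_le hNbdd ⟨z, hz, hz0, rfl⟩)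
  refine le_antisymm (iSup_le fun q => iSup_le fun hq => ENNReal.ofReal_le_ofReal (hadm_le q hq)) ?_
  refine le_of_forall_lt fun a ha => ?_
  have ha' : a ≠ ⊤ := ne_top_of_lt ha
  have hat : a.toReal < sInf N := by
    have := ENNReal.toReal_strict_mono ENNReal.ofReal_ne_top ha
    rwa [ENNReal.toReal_ofReal hN0] at this
  obtain ⟨q, hq1, hq2⟩ := exists_rat_btwn hat
  calc a = ENNReal.ofReal a.toReal := (ENNReal.ofReal_toReal ha').symm
    _ < ENNReal.ofReal (q : ℝ) := (ENNReal.ofReal_lt_ofReal_iff (by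
        exact_mod_cast lt_of_le_of_lt ENNReal.toReal_nonneg hq1)).2 hq1
    _ ≤ _ := le_iSup₂ (f := fun (q : ℚ) (_ : ((S.1 : LocalConfig (EuclideanSpace ℝ (Fin 3))).toMeasure)
          (closedBall 0 q) ≤ 1) => ENNReal.ofReal (q : ℝ)) q (hlt_adm q hq2)

/-! ## §3 Dilation equivariance -/

/-- The set of norms of the other points of the dilate is the dilated set. [folklore] -/
theorem norms_dilate {c : ℝ} (hc : 0 < c) (T : Set (EuclideanSpace ℝ (Fin 3))) :
    {r : ℝ | ∃ z ∈ (fun x : EuclideanSpace ℝ (Fin 3) => c • x) '' T, z ≠ 0 ∧ r = ‖z‖} =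
      c • {r : ℝ | ∃ z ∈ T, z ≠ 0 ∧ r = ‖z‖} := by
  ext r
  simp only [mem_setOf_eq, mem_image, Set.mem_smul_set, smul_eq_mul]
  constructor
  · rintro ⟨_, ⟨x, hx, rfl⟩, hz0, rfl⟩
    refine ⟨‖x‖, ⟨x, hx, fun h => hz0 (by rw [h, smul_zero]), rfl⟩, ?_⟩
    rw [norm_smul, Real.norm_of_nonneg hc.le]
  · rintro ⟨_, ⟨x, hx, hx0, rfl⟩, rfl⟩
    refine ⟨c • x, ⟨x, hx, rfl⟩, smul_ne_zero hc.ne' hx0, ?_⟩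
    rw [norm_smul, Real.norm_of_nonneg hc.le]

/-- **Dilation equivariance**: if the carrier of `Sc` is the dilate `(max c 1) • S` then
`ρ(Sc) = ofReal (max c 1) · ρ(S)`. [folklore] -/
theorem firstShell_dilate (c : ℝ) (S Sc : RootedHardCoreConfig (EuclideanSpace ℝ (Fin 3)) δ)
    (hcar : ((Sc.1 : LocalConfig (EuclideanSpace ℝ (Fin 3))) : Set (EuclideanSpace ℝ (Fin 3))) =
      (fun x : EuclideanSpace ℝ (Fin 3) => max c 1 • x) ''
        ((S.1 : LocalConfig (EuclideanSpace ℝ (Fin 3))) : Set (EuclideanSpace ℝ (Fin 3)))) :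
    (⨆ (q : ℚ) (_ : ((Sc.1 : LocalConfig (EuclideanSpace ℝ (Fin 3))).toMeasure) (closedBall 0 q) ≤ 1),
        ENNReal.ofReal (q : ℝ)) =
      ENNReal.ofReal (max c 1) *
        ⨆ (q : ℚ) (_ : ((S.1 : LocalConfig (EuclideanSpace ℝ (Fin 3))).toMeasure) (closedBall 0 q) ≤ 1),
          ENNReal.ofReal (q : ℝ) := by
  have ha : 0 < max c 1 := by positivity
  by_cases hone : ((S.1 : LocalConfig (EuclideanSpace ℝ (Fin 3))) : Set (EuclideanSpace ℝ (Fin 3))) = {0}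
  · -- the root alone: both sides are `⊤`
    have h1 : (⨆ (q : ℚ) (_ : ((S.1 : LocalConfig (EuclideanSpace ℝ (Fin 3))).toMeasure)
        (closedBall 0 q) ≤ 1), ENNReal.ofReal (q : ℝ)) = ⊤ := (firstShell_eq_top_iff S).2 hone
    have hone' : ((Sc.1 : LocalConfig (EuclideanSpace ℝ (Fin 3))) : Set (EuclideanSpace ℝ (Fin 3))) = {0} := by
      rw [hcar, hone, image_singleton, smul_zero]
    have h2 : (⨆ (q : ℚ) (_ : ((Sc.1 : LocalConfig (EuclideanSpace ℝ (Fin 3))).toMeasure)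
        (closedBall 0 q) ≤ 1), ENNReal.ofReal (q : ℝ)) = ⊤ := (firstShell_eq_top_iff Sc).2 hone'
    rw [h1, h2, ENNReal.mul_top (ENNReal.ofReal_pos.2 ha).ne']
  · -- another point: both sides are `ofReal` of infima, and the infimum dilates
    have hS : ∃ z ∈ ((S.1 : LocalConfig (EuclideanSpace ℝ (Fin 3))) : Set (EuclideanSpace ℝ (Fin 3))),
        z ≠ 0 := by
      by_contra hno
      push Not at hno
      exact hone (Set.eq_singleton_iff_unique_mem.2 ⟨S.2.1, hno⟩)
    obtain ⟨z₀, hz₀, hz₀0⟩ := hS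
    have hSc' : ∃ z ∈ ((Sc.1 : LocalConfig (EuclideanSpace ℝ (Fin 3))) : Set (EuclideanSpace ℝ (Fin 3))),
        z ≠ 0 := ⟨max c 1 • z₀, by rw [hcar]; exact ⟨z₀, hz₀, rfl⟩, smul_ne_zero ha.ne' hz₀0⟩
    rw [firstShell_eq_ofReal_sInf S ⟨z₀, hz₀, hz₀0⟩, firstShell_eq_ofReal_sInf Sc hSc',
      ← ENNReal.ofReal_mul ha.le]
    congr 1
    rw [hcar, norms_dilate ha, Real.sInf_smul_of_nonneg ha.le, smul_eq_mul]

/-! ## §4 On a rooted isometry class the functional takes values indexed by `Y` -/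

/-- **A rooted class confines the first-shell radius**: if `count|S` lies in the rooted isometry
class of `Y` then either `S` is the root alone or `ρ(S) = ofReal (inf {dist y q : y ∈ Y, y ≠ q})`
for some `q ∈ Y`. [folklore] -/
theorem firstShell_mem_of_mem_rootedClass
    (S : RootedHardCoreConfig (EuclideanSpace ℝ (Fin 3)) δ) {Y : Set (EuclideanSpace ℝ (Fin 3))}
    (hmem : ((S.1 : LocalConfig (EuclideanSpace ℝ (Fin 3))).toMeasure) ∈
      {μ : Measure (EuclideanSpace ℝ (Fin 3)) | ∃ A : EuclideanSpace ℝ (Fin 3) →ₗᵢ[ℝ]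
        EuclideanSpace ℝ (Fin 3), ∃ q ∈ Y, μ = (Measure.count : Measure
          (EuclideanSpace ℝ (Fin 3))).restrict ((fun s => A (s - q)) '' Y)}) :
    (⨆ (q : ℚ) (_ : ((S.1 : LocalConfig (EuclideanSpace ℝ (Fin 3))).toMeasure) (closedBall 0 q) ≤ 1),
        ENNReal.ofReal (q : ℝ)) = ⊤ ∨
      ∃ q ∈ Y, (⨆ (q : ℚ) (_ : ((S.1 : LocalConfig (EuclideanSpace ℝ (Fin 3))).toMeasure)
          (closedBall 0 q) ≤ 1), ENNReal.ofReal (q : ℝ)) =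
        ENNReal.ofReal (sInf {r : ℝ | ∃ y ∈ Y, y ≠ q ∧ r = dist y q}) := by
  obtain ⟨A, q, hq, hSe⟩ := hmem
  rw [toMeasure_def] at hSe
  have hcar := set_eq_of_count_restrict_eq hSe
  by_cases hone : ((S.1 : LocalConfig (EuclideanSpace ℝ (Fin 3))) : Set (EuclideanSpace ℝ (Fin 3))) = {0}
  · exact Or.inl ((firstShell_eq_top_iff S).2 hone)
  · right
    refine ⟨q, hq, ?_⟩
    have hS : ∃ z ∈ ((S.1 : LocalConfig (EuclideanSpace ℝ (Fin 3))) : Set (EuclideanSpace ℝ (Fin 3))),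
        z ≠ 0 := by
      by_contra hno
      push Not at hno
      exact hone (Set.eq_singleton_iff_unique_mem.2 ⟨S.2.1, hno⟩)
    rw [firstShell_eq_ofReal_sInf S hS]
    congr 2
    ext r
    simp only [mem_setOf_eq]
    rw [hcar]
    constructor
    · rintro ⟨_, ⟨y, hy, rfl⟩, hz0, rfl⟩
      refine ⟨y, hy, fun h => hz0 (by simp [h]), ?_⟩
      rw [A.norm_map, dist_eq_norm]
    · rintro ⟨y, hy, hyq, rfl⟩
      refine ⟨A (y - q), ⟨y, hy, rfl⟩, fun h => hyq ?_, by rw [A.norm_map, dist_eq_norm]⟩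
      have : ‖y - q‖ = 0 := by rw [← A.norm_map, h, norm_zero]
      exact sub_eq_zero.1 (norm_eq_zero.1 this)

/-- If the rooted class of `Y` meets a rooted hard-core configuration then `Y` is countable.
[folklore] -/
theorem countable_of_mem_rootedClass (hδ : 0 < δ)
    (S : RootedHardCoreConfig (EuclideanSpace ℝ (Fin 3)) δ) {Y : Set (EuclideanSpace ℝ (Fin 3))}
    (hmem : ((S.1 : LocalConfig (EuclideanSpace ℝ (Fin 3))).toMeasure) ∈
      {μ : Measure (EuclideanSpace ℝ (Fin 3)) | ∃ A : EuclideanSpace ℝ (Fin 3) →ₗᵢ[ℝ]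
        EuclideanSpace ℝ (Fin 3), ∃ q ∈ Y, μ = (Measure.count : Measure
          (EuclideanSpace ℝ (Fin 3))).restrict ((fun s => A (s - q)) '' Y)}) :
    Y.Countable := by
  obtain ⟨A, q, -, hSe⟩ := hmem
  rw [toMeasure_def] at hSe
  have hcar := set_eq_of_count_restrict_eq hSe
  have hinj : Injective fun s : EuclideanSpace ℝ (Fin 3) => A (s - q) :=
    fun s t h => sub_left_injective (A.injective h)
  have hcnt : ((fun s : EuclideanSpace ℝ (Fin 3) => A (s - q)) '' Y).Countable := by
    rw [← hcar]
    exact Summit.AtomisticToContinuum.Crystallization.Theorems.UnimodularEnergy.countable_of_separated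
      hδ S.2.2
  exact Set.countable_of_injective_of_countable_image hinj.injOn hcnt

end Summit.AtomisticToContinuum.Crystallization.Theorems.MinimisingLawsHaveAtoms.Negative.FirstShellRadius

end
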